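import Mathlib
import Summits.Ventures.PercRepro2.SwOutCrossBaseBlock
import Summits.Ventures.PercRepro2.SwOutCrossBaseMarkM
import Summits.Ventures.PercRepro2.SwOutCrossBaseBlueEdgesM

/-!
# THE BLOCK THEOREM OF A JUNCTION WITH ANY DROPPED STRUCTURE WHOSE FIBRE HAS THE INEQUALITY, and
the case of TWO connected dropped components (blind cell PercRepro2, night-4 g25, 2026-08-28;
proofs/NIGHT4-G25.md §3)

`SwOutCrossBaseBlock` re-stated on the minimal record: **`CrossBase.rigid_block_crossM`** — for a
cross base with ANY cross graph `G` whose record `fibKEEMin G` satisfies the abstract inequality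
`IneqM` over the u-arms, the block `blockCX` satisfies the rigid counting inequality of (SW) on its
`Q`-part (the root `l` outside the structure, the mark `o` anywhere but at `u` or a dropped
vertex) for every up-set of edge sets.  The proof is the landed one verbatim, the abstract theorem
`card_le_crossGenFarM` taking the inequality as its hypothesis.  Instances: a connected `G`
(`rigid_block_cross'`, from `ineqM_fibKEE` — the landed theorem again) and
**`rigid_block_cross₂`**: the dropped vertices form TWO connected components `G₁ ⊕g G₂` on
`X₁ ⊕ X₂` (from `ineqM_fibKEESum₂`, the joint order) — THE GEOMETRIC BLOCK THEOREM OF TWO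
COMPONENTS AT ONE JUNCTION.
-/

namespace Summit.Ventures.PercRepro2

namespace CrossArm

open Hull LocRows

variable {V E : Type*}

open scoped Classical

section Order

variable {ι X κ : Type*} {G : SimpleGraph X} [Fintype X] [DecidableEq X] [DecidableRel G.Adj]
  [Nonempty X]

omit [Fintype X] [DecidableEq X] [DecidableRel G.Adj] [Nonempty X] in
/-- The order of `card_le_crossGenFar` on the edge-atom fibre data is reflexive. -/
lemma betterFM_refl (x : PtXG ι κ X G) :
    BetterFM (fibKEEMin G) (typFM (fibKEEMin G) (toGen G x)) (typFM (fibKEEMin G) (toGen G x)) :=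
  betterFM_iff.2 ⟨fun _ h => h, fun _ h => h, fun _ h => h, fun _ _ h => h, fun _ _ h => h⟩

omit [Fintype X] [DecidableEq X] [DecidableRel G.Adj] [Nonempty X] in
/-- The order of `card_le_crossGenFar` on the edge-atom fibre data is transitive. -/
lemma betterFM_trans {t₁ t₂ t₃ : TypFG (LabelKE X) ι κ} (h₁ : BetterFM (fibKEEMin G) t₂ t₁)
    (h₂ : BetterFM (fibKEEMin G) t₃ t₂) : BetterFM (fibKEEMin G) t₃ t₁ :=
  ⟨fun k hk => h₂.1 k (h₁.1 k hk), fun j hj => h₂.2.1 j (h₁.2.1 j hj),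
    betterKE_trans h₁.2.2 h₂.2.2⟩

end Order

section Block

variable {ι X κ : Type*} [Fintype ι] [DecidableEq ι] [Nonempty ι] [Fintype κ] [DecidableEq κ]
  [Fintype X] [DecidableEq X] [Nonempty X] {G : SimpleGraph X} [DecidableRel G.Adj]
  [Fintype E] [DecidableEq E]

variable {ends : E → Sym2 V} {σ : Config E} {h u : V} {U : ι → Set V} {p : X → V}
  {F : κ → Set V} (hineq : IneqM (fibKEEMin G) (ι := ι)) (hb : CrossBase ends σ h u U p G F)
include hineq hb

omit [Nonempty ι] [Nonempty X] in
/-- **THE BLOCK THEOREM OF A JUNCTION WITH A CONNECTED DROPPED COMPONENT**: the rigid counting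
inequality on the block of a cross base, for every up-set of edge sets, with the root `l` outside
the structure and the mark `o` anywhere but at `u` or a dropped vertex. -/
theorem CrossBase.rigid_block_crossM (hup : ∀ i, ∃ e, ends e = s(u, p i))
    (hcross : ∀ i j, G.Adj i j → ∃ e, ends e = s(p i, p j))
    (hcrossE : ∀ s : G.edgeSet, ∃ e, e ∈ clsCX ends p G s)
    (hFe : ∀ k, ∃ e, e ∈ touches ends (F k)) (hext : ∀ i, ∃ e, e ∈ clsExtX ends u p i)
    {l o : V} (hl : l ∉ strX h u U p F) (hou : o ≠ u) (hop : ∀ i, o ≠ p i)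
    {𝓔 : Set (Set E)} (h𝓔 : IsUpperSet 𝓔) :
    ((blockCX ends σ u U p G F).filter fun ζ =>
        ζ ∈ (tgtU ends l h {S : Set V | o ∈ S} : Set (Config E)) ∧ redEdges ends ζ h ∈ 𝓔).card ≤
      ((blockCX ends σ u U p G F).filter fun ζ =>
        ζ ∈ (tgtU ends l h {S : Set V | o ∈ S} : Set (Config E)) ∧
          blueEdges ends ζ h ∈ 𝓔).card := by
  have hinj := hb.crossReal_injective hFe hup hcrossE hext
  -- the up-closure of the types of the conditioning
  let 𝒯 : Set (TypFG (LabelKE X) ι κ) := {t | ∃ q : PtXG ι κ X G, ¬ LeakRX G q ∧ ¬ LeakBX G q ∧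
    crossReal ends u U p G F σ q ∈ (tgtU ends l h {S : Set V | o ∈ S} : Set (Config E)) ∧
    BetterFM (fibKEEMin G) t (typFM (fibKEEMin G) (toGen G q))}
  have h𝒯 : IsUpFM (fibKEEMin G) 𝒯 := by
    rintro t ⟨q, hqR, hqB, hq, hle⟩ t' hle'
    exact ⟨q, hqR, hqB, hq, betterFM_trans hle hle'⟩
  -- the pulled-back conditioning is `QFG 𝒯` (the type lemma)
  have hQ : QFM (fibKEEMin G) 𝒯 = Finset.univ.filter fun q : PtXG ι κ X G =>
      ¬ LeakRX G q ∧ ¬ LeakBX G q ∧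
        crossReal ends u U p G F σ q ∈ (tgtU ends l h {S : Set V | o ∈ S} : Set (Config E)) := by
    ext q
    simp only [QFM, Finset.mem_filter, Finset.mem_univ, true_and]
    have hleak : ¬ LeakM (fibKEEMin G) q.2 ↔ ¬ (LeakRX G q ∨ LeakBX G q) :=
      (leakM_toGen_iff q).not
    rw [hleak, not_or]
    constructor
    · rintro ⟨⟨hqR, hqB⟩, q₀, hq₀R, hq₀B, hq₀, hle⟩
      exact ⟨hqR, hqB, hb.mem_tgtU_of_betterFM_mark hup hcross hq₀R hqR hqB hle hl hou hop hq₀⟩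
    · rintro ⟨hqR, hqB, hq⟩
      exact ⟨⟨hqR, hqB⟩, q, hqR, hqB, hq, betterFM_refl q⟩
  have h𝓔' : IsUpperSet (φX ends σ h u U p G F ⁻¹' 𝓔) :=
    h𝓔.preimage (φX_mono ends σ h u U p G F)
  have key := card_le_crossGenFarM (F := fibKEEMin G) hineq h𝒯 h𝓔'
  have e1 : ((blockCX ends σ u U p G F).filter fun ζ =>
      ζ ∈ (tgtU ends l h {S : Set V | o ∈ S} : Set (Config E)) ∧ redEdges ends ζ h ∈ 𝓔) =
      ((QFM (fibKEEMin G) 𝒯).filter fun q => ERFM (fibKEEMin G) q ∈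
        φX ends σ h u U p G F ⁻¹' 𝓔).image (crossReal ends u U p G F σ) := by
    ext ζ
    simp only [blockCX, hQ, Finset.mem_filter, Finset.mem_image, Finset.mem_univ, true_and,
      Set.mem_preimage]
    constructor
    · rintro ⟨⟨q, ⟨hqR, hqB⟩, rfl⟩, hq, hE⟩
      refine ⟨q, ⟨⟨hqR, hqB, hq⟩, ?_⟩, rfl⟩
      rw [hb.redEdges_crossRealM hup hcross hqR] at hE
      exact hE
    · rintro ⟨q, ⟨⟨hqR, hqB, hq⟩, hE⟩, rfl⟩
      refine ⟨⟨q, ⟨hqR, hqB⟩, rfl⟩, hq, ?_⟩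
      rw [hb.redEdges_crossRealM hup hcross hqR]
      exact hE
  have e2 : ((blockCX ends σ u U p G F).filter fun ζ =>
      ζ ∈ (tgtU ends l h {S : Set V | o ∈ S} : Set (Config E)) ∧ blueEdges ends ζ h ∈ 𝓔) =
      ((QFM (fibKEEMin G) 𝒯).filter fun q => EBFM (fibKEEMin G) q ∈
        φX ends σ h u U p G F ⁻¹' 𝓔).image (crossReal ends u U p G F σ) := by
    ext ζ
    simp only [blockCX, hQ, Finset.mem_filter, Finset.mem_image, Finset.mem_univ, true_and,
      Set.mem_preimage]
    constructor
    · rintro ⟨⟨q, ⟨hqR, hqB⟩, rfl⟩, hq, hE⟩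
      refine ⟨q, ⟨⟨hqR, hqB, hq⟩, ?_⟩, rfl⟩
      rw [hb.blueEdges_crossRealM hup hcross hqB] at hE
      exact hE
    · rintro ⟨q, ⟨⟨hqR, hqB, hq⟩, hE⟩, rfl⟩
      refine ⟨⟨q, ⟨hqR, hqB⟩, rfl⟩, hq, ?_⟩
      rw [hb.blueEdges_crossRealM hup hcross hqB]
      exact hE
  rw [e1, e2, Finset.card_image_of_injective _ hinj, Finset.card_image_of_injective _ hinj]
  exact key

end Block

section Instances

variable {ι κ : Type*} [Fintype ι] [DecidableEq ι] [Nonempty ι] [Fintype κ] [DecidableEq κ]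
  [Fintype E] [DecidableEq E]

/-- **The block theorem of a junction with a connected dropped component**, from the record. -/
theorem CrossBase.rigid_block_cross' {X : Type*} [Fintype X] [DecidableEq X] [Nonempty X]
    {G : SimpleGraph X} [DecidableRel G.Adj] (hG : G.Connected)
    {ends : E → Sym2 V} {σ : Config E} {h u : V} {U : ι → Set V} {p : X → V} {F : κ → Set V}
    (hb : CrossBase ends σ h u U p G F)
    (hup : ∀ i, ∃ e, ends e = s(u, p i))
    (hcross : ∀ i j, G.Adj i j → ∃ e, ends e = s(p i, p j))
    (hcrossE : ∀ s : G.edgeSet, ∃ e, e ∈ clsCX ends p G s)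
    (hFe : ∀ k, ∃ e, e ∈ touches ends (F k)) (hext : ∀ i, ∃ e, e ∈ clsExtX ends u p i)
    {l o : V} (hl : l ∉ strX h u U p F) (hou : o ≠ u) (hop : ∀ i, o ≠ p i)
    {𝓔 : Set (Set E)} (h𝓔 : IsUpperSet 𝓔) :
    ((blockCX ends σ u U p G F).filter fun ζ =>
        ζ ∈ (tgtU ends l h {S : Set V | o ∈ S} : Set (Config E)) ∧ redEdges ends ζ h ∈ 𝓔).card ≤
      ((blockCX ends σ u U p G F).filter fun ζ =>
        ζ ∈ (tgtU ends l h {S : Set V | o ∈ S} : Set (Config E)) ∧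
          blueEdges ends ζ h ∈ 𝓔).card :=
  hb.rigid_block_crossM (ineqM_fibKEE G hG) hup hcross hcrossE hFe hext hl hou hop h𝓔

/-- **THE BLOCK THEOREM OF A JUNCTION WITH TWO CONNECTED DROPPED COMPONENTS**: the dropped
vertices `p i`, `i : X₁ ⊕ X₂`, joined among themselves along `G₁ ⊕g G₂` (each part connected, no
edge between the parts). -/
theorem CrossBase.rigid_block_cross₂ {X₁ X₂ : Type*} [Fintype X₁] [DecidableEq X₁] [Nonempty X₁]
    [Fintype X₂] [DecidableEq X₂] [Nonempty X₂] {G₁ : SimpleGraph X₁} {G₂ : SimpleGraph X₂}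
    [DecidableRel G₁.Adj] [DecidableRel G₂.Adj] (hG₁ : G₁.Connected) (hG₂ : G₂.Connected)
    {ends : E → Sym2 V} {σ : Config E} {h u : V} {U : ι → Set V} {p : X₁ ⊕ X₂ → V}
    {F : κ → Set V} (hb : CrossBase ends σ h u U p (G₁ ⊕g G₂) F)
    (hup : ∀ i, ∃ e, ends e = s(u, p i))
    (hcross : ∀ i j, (G₁ ⊕g G₂).Adj i j → ∃ e, ends e = s(p i, p j))
    (hcrossE : ∀ s : (G₁ ⊕g G₂).edgeSet, ∃ e, e ∈ clsCX ends p (G₁ ⊕g G₂) s)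
    (hFe : ∀ k, ∃ e, e ∈ touches ends (F k)) (hext : ∀ i, ∃ e, e ∈ clsExtX ends u p i)
    {l o : V} (hl : l ∉ strX h u U p F) (hou : o ≠ u) (hop : ∀ i, o ≠ p i)
    {𝓔 : Set (Set E)} (h𝓔 : IsUpperSet 𝓔) :
    ((blockCX ends σ u U p (G₁ ⊕g G₂) F).filter fun ζ =>
        ζ ∈ (tgtU ends l h {S : Set V | o ∈ S} : Set (Config E)) ∧ redEdges ends ζ h ∈ 𝓔).card ≤
      ((blockCX ends σ u U p (G₁ ⊕g G₂) F).filter fun ζ =>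
        ζ ∈ (tgtU ends l h {S : Set V | o ∈ S} : Set (Config E)) ∧
          blueEdges ends ζ h ∈ 𝓔).card :=
  hb.rigid_block_crossM (ineqM_fibKEESum₂ G₁ G₂ hG₁ hG₂) hup hcross hcrossE hFe hext hl hou hop h𝓔

end Instances

end CrossArm

end Summit.Ventures.PercRepro2
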